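import Literature.NumberTheory.Sieve.GoldbachSieveConstantEight
import HarnessLib

/-!
# Friable two-residue Selberg sums `QB b Y` and the Buchstab-step certificate rules

Part 1 of 3 of the kernel certificate `Q_∅(4096) ≥ 45.6` (`TwoResidueSelbergSumSmall.Qsum_4096_ge`); the
certificate itself is in `TwoResidueSelbergSumSmallChain` (states up to the prime `2039`) and
`TwoResidueSelbergSumSmall` (the rest and the headline) — three modules only because the gate caps one file at
200 000 bytes; all three share the namespace `Literature.NumberTheory.Sieve.TwoResidueSelbergSumSmall`.

`Q_∅(X) = ∑_{ℓ ≤ X, ℓ squarefree} ∏_{p ∣ ℓ} w(p)` (`w(2) = 1`, `w(p) = 2/(p − 2)`), the denominator of the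
arithmetic large sieve for prime pairs (`GoldbachSieveEight.card_primePairs_mul_Qsum_le`, valid for EVERY
`X ≥ 1`).  The tree bounds `Q_∅(X)` from below only asymptotically (`Qsum_ge_kappa4`, `X ≥ 2^22`), which is
what puts the threshold `e^32` under every explicit pair sieve of the tree.  Here `Q_∅(X)` is certified at a
FIXED small `X` by a Buchstab-type chain over the primes: with
`QB b Y := ∑_{ℓ ≤ Y, ℓ squarefree, every prime factor of ℓ < b} ∏_{p ∣ ℓ} w(p)` one has
`QB (p+1) Y ≥ QB p Y + w(p) · QB p ⌊Y/p⌋` (`p` prime), `QB` monotone in both arguments, `QB b Y ≥ 1`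
(`Y ≥ 1`) and `QB b X ≤ Q_∅(X)`; a generated chain of such steps with rounded-down decimal values is
checked by `norm_num` one step at a time (1203 chain states, 564 primality facts; generator `gen48q.py`).
Consumer: `RomanoffExplicitAllN27` (`pairCount_le_linear`: a prime-pair sieve WITHOUT threshold, hence
Romanoff's theorem with constant `1/27` for all `N ≥ 4`).
Origin: research cell parity-ideate (seat p5, ROUND-48 «NO THRESHOLD», 2026-08-29); kernel-checked there verbatim.
-/

open Finset

namespace Literature.NumberTheory.Sieve.TwoResidueSelbergSumSmall

open Literature.NumberTheory.Sieve.GoldbachSieveEight (trw Qsum)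

/-- The index set of `QB b Y`: squarefree `1 ≤ ℓ ≤ Y` all of whose prime factors are `< b`. [folklore] -/
def idx (b Y : ℕ) : Finset ℕ :=
  (Icc 1 Y).filter (fun ℓ => Squarefree ℓ ∧ ∀ q ∈ ℓ.primeFactors, q < b)

/-- The summand `∏_{p ∣ ℓ} w_∅(p)`. [folklore] -/
noncomputable def wprod (ℓ : ℕ) : ℝ := ∏ q ∈ ℓ.primeFactors, trw ∅ q

/-- `QB b Y = ∑_{ℓ ≤ Y squarefree, P⁺(ℓ) < b} ∏_{p ∣ ℓ} w_∅(p)` — the Selberg sum restricted to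
`(b−1)`-friable moduli. [folklore] -/
noncomputable def QB (b Y : ℕ) : ℝ := ∑ ℓ ∈ idx b Y, wprod ℓ

/-- Membership in the index set.
[cite: BatemanDiamond2004, §13.4 (13.14) and Lemma 13.10, pp. 325–326 (friable partial sums of the printed sum; elementary, proved here)] -/
theorem mem_idx {b Y ℓ : ℕ} :
    ℓ ∈ idx b Y ↔ (1 ≤ ℓ ∧ ℓ ≤ Y) ∧ Squarefree ℓ ∧ ∀ q ∈ ℓ.primeFactors, q < b := by
  unfold idx
  rw [mem_filter, mem_Icc]

/-- `w_∅(p) ≥ 0` at primes.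
[cite: BatemanDiamond2004, §13.4 (13.14) and Lemma 13.10, pp. 325–326 (friable partial sums of the printed sum; elementary, proved here)] -/
theorem trw_empty_nonneg {p : ℕ} (hp : p.Prime) : 0 ≤ trw ∅ p := by
  unfold trw
  have h2 : (2 : ℝ) ≤ p := by exact_mod_cast hp.two_le
  split_ifs with h h'
  · exact zero_le_one
  · exact absurd h' (by simp)
  · have h3 : (3 : ℝ) ≤ p := by
      have := hp.two_le
      exact_mod_cast (show 3 ≤ p by omega)
    exact div_nonneg zero_le_two (by linarith)

/-- `wprod ℓ ≥ 0`.
[cite: BatemanDiamond2004, §13.4 (13.14) and Lemma 13.10, pp. 325–326 (friable partial sums of the printed sum; elementary, proved here)] -/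
theorem wprod_nonneg (ℓ : ℕ) : 0 ≤ wprod ℓ :=
  prod_nonneg fun _ hq => trw_empty_nonneg (Nat.prime_of_mem_primeFactors hq)

/-- `QB b X ≤ Q_∅(X)`.
[cite: BatemanDiamond2004, §13.4 (13.14) and Lemma 13.10, pp. 325–326 (friable partial sums of the printed sum; elementary, proved here)] -/
theorem QB_le_Qsum (b X : ℕ) : QB b X ≤ Qsum ∅ X := by
  unfold QB Qsum
  refine sum_le_sum_of_subset_of_nonneg (fun ℓ hℓ => ?_) (fun ℓ _ _ => wprod_nonneg ℓ)
  rw [mem_idx] at hℓ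
  rw [mem_filter, mem_Icc]
  exact ⟨hℓ.1, hℓ.2.1⟩

/-- `QB` is monotone in both arguments.
[cite: BatemanDiamond2004, §13.4 (13.14) and Lemma 13.10, pp. 325–326 (friable partial sums of the printed sum; elementary, proved here)] -/
theorem QB_mono {b b' Y Y' : ℕ} (hb : b ≤ b') (hY : Y ≤ Y') : QB b Y ≤ QB b' Y' := by
  unfold QB
  refine sum_le_sum_of_subset_of_nonneg (fun ℓ hℓ => ?_) (fun ℓ _ _ => wprod_nonneg ℓ)
  rw [mem_idx] at hℓ ⊢
  exact ⟨⟨hℓ.1.1, hℓ.1.2.trans hY⟩, hℓ.2.1, fun q hq => (hℓ.2.2 q hq).trans_le hb⟩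

/-- `QB b Y ≥ 1` for `Y ≥ 1` (the term `ℓ = 1`).
[cite: BatemanDiamond2004, §13.4 (13.14) and Lemma 13.10, pp. 325–326 (friable partial sums of the printed sum; elementary, proved here)] -/
theorem one_le_QB (b : ℕ) {Y : ℕ} (hY : 1 ≤ Y) : (1 : ℝ) ≤ QB b Y := by
  unfold QB
  have h1 : (1 : ℕ) ∈ idx b Y := by
    rw [mem_idx]
    exact ⟨⟨le_rfl, hY⟩, squarefree_one, fun q hq => by simp at hq⟩
  calc (1 : ℝ) = wprod 1 := by simp [wprod]
    _ ≤ ∑ ℓ ∈ idx b Y, wprod ℓ := single_le_sum (fun ℓ _ => wprod_nonneg ℓ) h1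

/-- **The chain step** `QB p Y + w(p)·QB p ⌊Y/p⌋ ≤ QB (p+1) Y` (`p` prime): the new moduli are `ℓ = p·m`,
`m ≤ Y/p` squarefree and `(p−1)`-friable, with `∏_{q ∣ pm} w(q) = w(p) ∏_{q ∣ m} w(q)`.
[cite: BatemanDiamond2004, §13.4 proof of Lemma 13.11, (13.16) p. 327 (the partition at p = 2 is printed; general prime p and the friable restriction proved here)] -/
theorem QB_step {p : ℕ} (hp : p.Prime) (Y : ℕ) :
    QB p Y + trw ∅ p * QB p (Y / p) ≤ QB (p + 1) Y := by
  have hp0 : p ≠ 0 := hp.ne_zero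
  have hBfacts : ∀ m ∈ idx p (Y / p),
      m ≠ 0 ∧ p * m ≤ Y ∧ Squarefree m ∧ (∀ q ∈ m.primeFactors, q < p) ∧ Nat.Coprime p m := by
    intro m hm
    rw [mem_idx] at hm
    obtain ⟨⟨hm1, hmY⟩, hsq, hlt⟩ := hm
    refine ⟨by omega, (Nat.mul_le_mul_left p hmY).trans (Nat.mul_div_le Y p), hsq, hlt, ?_⟩
    rw [Nat.Prime.coprime_iff_not_dvd hp]
    intro hdvd
    have : p ∈ m.primeFactors := Nat.mem_primeFactors.mpr ⟨hp, hdvd, by omega⟩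
    exact lt_irrefl p (hlt p this)
  have hA₁A : idx p Y ⊆ idx (p + 1) Y := by
    intro ℓ hℓ
    rw [mem_idx] at hℓ ⊢
    exact ⟨hℓ.1, hℓ.2.1, fun q hq => (hℓ.2.2 q hq).trans (Nat.lt_succ_self p)⟩
  have hA₂A : (idx p (Y / p)).image (fun m => p * m) ⊆ idx (p + 1) Y := by
    intro ℓ hℓ
    rw [mem_image] at hℓ
    obtain ⟨m, hm, rfl⟩ := hℓ
    obtain ⟨hm0, hmY, hsq, hlt, hcop⟩ := hBfacts m hm
    rw [mem_idx]
    refine ⟨⟨Nat.one_le_iff_ne_zero.mpr (Nat.mul_ne_zero hp0 hm0), hmY⟩, ?_, ?_⟩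
    · exact (Nat.squarefree_mul hcop).mpr ⟨(Nat.prime_iff.mp hp).squarefree, hsq⟩
    · intro q hq
      rw [Nat.primeFactors_mul hp0 hm0, mem_union, Nat.Prime.primeFactors hp, mem_singleton] at hq
      rcases hq with rfl | hq
      · exact Nat.lt_succ_self _
      · exact (hlt q hq).trans (Nat.lt_succ_self p)
  have hdisj : Disjoint (idx p Y) ((idx p (Y / p)).image (fun m => p * m)) := by
    rw [Finset.disjoint_left]
    intro ℓ hℓ₁ hℓ₂
    rw [mem_idx] at hℓ₁
    rw [mem_image] at hℓ₂
    obtain ⟨m, hm, rfl⟩ := hℓ₂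
    obtain ⟨hm0, -, -, -, -⟩ := hBfacts m hm
    have : p ∈ (p * m).primeFactors :=
      Nat.mem_primeFactors.mpr ⟨hp, dvd_mul_right p m, Nat.mul_ne_zero hp0 hm0⟩
    exact lt_irrefl p (hℓ₁.2.2 p this)
  have himage : ∑ ℓ ∈ (idx p (Y / p)).image (fun m => p * m), wprod ℓ
      = trw ∅ p * ∑ m ∈ idx p (Y / p), wprod m := by
    rw [sum_image (fun a _ b _ h => Nat.eq_of_mul_eq_mul_left hp.pos h), mul_sum]
    refine sum_congr rfl fun m hm => ?_
    obtain ⟨hm0, -, -, -, hcop⟩ := hBfacts m hm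
    unfold wprod
    rw [Nat.Coprime.primeFactors_mul hcop, prod_union (Nat.Coprime.disjoint_primeFactors hcop),
      Nat.Prime.primeFactors hp, prod_singleton]
  unfold QB
  calc ∑ ℓ ∈ idx p Y, wprod ℓ + trw ∅ p * ∑ m ∈ idx p (Y / p), wprod m
      = ∑ ℓ ∈ idx p Y, wprod ℓ + ∑ ℓ ∈ (idx p (Y / p)).image (fun m => p * m), wprod ℓ := by rw [himage]
    _ = ∑ ℓ ∈ idx p Y ∪ (idx p (Y / p)).image (fun m => p * m), wprod ℓ := (sum_union hdisj).symm
    _ ≤ ∑ ℓ ∈ idx (p + 1) Y, wprod ℓ :=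
        sum_le_sum_of_subset_of_nonneg (union_subset hA₁A hA₂A) fun ℓ _ _ => wprod_nonneg ℓ

/-! ### The certificate rules (every numeric side condition is closed by `norm_num` / `decide`) -/

/-- Base: `1 ≤ QB 0 Y` for `Y ≥ 1`.
[cite: BatemanDiamond2004, §13.4 (13.14) and Lemma 13.10, pp. 325–326 (friable partial sums of the printed sum; elementary, proved here)] -/
theorem cert_base {Y : ℕ} (hY : 1 ≤ Y) : (1 : ℝ) ≤ QB 0 Y := one_le_QB 0 hY

/-- Step at `p = 2` (`w(2) = 1`).
[cite: BatemanDiamond2004, §13.4 proof of Lemma 13.11, (13.16) p. 327 (the partition at p = 2 is printed; general prime p and the friable restriction proved here)] -/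
theorem cert_two {Y b₀ b₁ Y₁ : ℕ} {v v₁ v₂ : ℝ} (h₁ : v₁ ≤ QB b₀ Y) (h₂ : v₂ ≤ QB b₁ Y₁)
    (hb₀ : b₀ ≤ 2) (hb₁ : b₁ ≤ 2) (hY₁ : Y₁ ≤ Y / 2) (hv : v ≤ v₁ + v₂) : v ≤ QB 3 Y := by
  have hs := QB_step Nat.prime_two Y
  have ht : trw ∅ 2 = 1 := by simp [trw]
  have m₁ := QB_mono hb₀ (le_refl Y)
  have m₂ := QB_mono hb₁ hY₁
  rw [ht, one_mul] at hs
  linarith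

/-- Step at an odd prime `p` (`w(p) = 2/(p − 2)`).
[cite: BatemanDiamond2004, §13.4 proof of Lemma 13.11, (13.16) p. 327 (the partition at p = 2 is printed; general prime p and the friable restriction proved here)] -/
theorem cert_odd {p Y b₀ b₁ Y₁ : ℕ} {v v₁ v₂ : ℝ} (hp : p.Prime) (hp2 : p ≠ 2) (h₁ : v₁ ≤ QB b₀ Y)
    (h₂ : v₂ ≤ QB b₁ Y₁) (hb₀ : b₀ ≤ p) (hb₁ : b₁ ≤ p) (hY₁ : Y₁ ≤ Y / p)
    (hv : (v - v₁) * ((p : ℝ) - 2) ≤ 2 * v₂) : v ≤ QB (p + 1) Y := by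
  have hs := QB_step hp Y
  have h3 : (3 : ℝ) ≤ p := by
    have := hp.two_le
    exact_mod_cast (show 3 ≤ p by omega)
  have ht : trw ∅ p = 2 / ((p : ℝ) - 2) := by simp [trw, hp2]
  have m₁ := QB_mono hb₀ (le_refl Y)
  have m₂ := QB_mono hb₁ hY₁
  have hpos : (0 : ℝ) < (p : ℝ) - 2 := by linarith
  have htrw0 : 0 ≤ trw ∅ p := by rw [ht]; positivity
  have hvv : v ≤ v₁ + trw ∅ p * v₂ := by
    rw [ht]
    have : v - v₁ ≤ 2 / ((p : ℝ) - 2) * v₂ := by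
      rw [div_mul_eq_mul_div, le_div_iff₀ hpos]; linarith
    linarith
  have hmul := mul_le_mul_of_nonneg_left (h₂.trans m₂) htrw0
  linarith

/-- Test of the rules: `QB 4 6 ≥ 6` (`ℓ ∈ {1,2,3,6}`: `1 + 1 + 2 + 2`). [folklore] -/
example : (6 : ℝ) ≤ QB 4 6 := by
  have a6 : (1 : ℝ) ≤ QB 0 6 := cert_base (by decide)
  have a3 : (1 : ℝ) ≤ QB 0 3 := cert_base (by decide)
  have a2 : (1 : ℝ) ≤ QB 0 2 := cert_base (by decide)
  have a1 : (1 : ℝ) ≤ QB 0 1 := cert_base (by decide)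
  have b6 : (2 : ℝ) ≤ QB 3 6 := cert_two a6 a3 (by decide) (by decide) (by decide) (by norm_num)
  have b2 : (2 : ℝ) ≤ QB 3 2 := cert_two a2 a1 (by decide) (by decide) (by decide) (by norm_num)
  exact cert_odd (p := 3) (by norm_num) (by decide) b6 b2 (by decide) (by decide) (by decide) (by norm_num)

end Literature.NumberTheory.Sieve.TwoResidueSelbergSumSmall
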